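import Mathlib

/-!
# Prep lemmas for idea `core-distance-morse` (crux `InformationMetricHadamard.C0AhRecognition`)

Lead's groundwork (not a line, not a stub): the real-analysis core of the first lemma
`NearestPointSpread` in the Minkowski form of `Cruxes/C0AhRecognition/NOTES.md` (addendum 15:50Z).

* `sqrt_sq_integral_add_sq_integral_le` — planar Minkowski `√((∫p)²+(∫q)²) ≤ ∫√(p²+q²)`;
  `integral_le_sqrt_sq_sub_sq` — `∫√(p²+q²) ≤ L`, `ℓ ≤ ∫p` ⇒ `∫q ≤ √(L²−ℓ²)` (the form with slack).
* `integral_le_mul_sqrt_sq_sub_one` — if `∫ √(p² + q²) ≤ r·ℓ` and `ℓ ≤ ∫ p` on `[a,b]` with `1 < r`, then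
  `∫ q ≤ ℓ·√(r² − 1)` (test Minkowski's inequality against the unit vector `(1/r, √(r²−1)/r)`).
* `log_div_le_integral_abs_deriv_div` — for `λ` of class `C¹` and positive on `[a,b]`,
  `log (λ b / λ a) ≤ ∫_a^b |λ'|/λ`.
* `two_mul_r_sqrt_lt_sqrt_two` — the numerical punchline at `ε = 1/20`: `2 r √(r² − 1) < √2` for
  `r = √(21/19)` (`r² (r² − 1) = 42/361 < 1/2`).

In the application `p = |λ'|/λ` (vertical cone speed), `q = |x'|_g/λ ≥ |x'|_g/s` (horizontal cone speed
below level `s`), `ℓ = log(s/λ₀)`, `r = √((1+ε)/(1−ε))`: the feet of near-minimisers from `Φ(x₀,λ₀)` to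
`K_s` lie within `g`-distance `s·√(r²−1)·log(s/λ₀)` of `x₀`, whence the `√2`-spread with ratio
`2r√(r²−1) = 0.682…` at `ε = 1/20`.
-/

noncomputable section

-- the prescribed namespace `Summit.<P>.<Sub>.…` duplicates `SmoothPoincare4` (P = Sub)
set_option linter.dupNamespace false

open MeasureTheory Set Real intervalIntegral

namespace Summit.SmoothPoincare4.SmoothPoincare4.Cruxes.C0AhRecognition.Prep

/-- Pointwise Cauchy–Schwarz in the plane: for `α² + β² ≤ 1`, `α p + β q ≤ √(p² + q²)`. [folklore] -/
theorem mul_add_mul_le_sqrt_sq_add_sq {α β : ℝ} (h : α ^ 2 + β ^ 2 ≤ 1) (p q : ℝ) :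
    α * p + β * q ≤ Real.sqrt (p ^ 2 + q ^ 2) := by
  by_cases hs : α * p + β * q ≤ 0
  · exact hs.trans (Real.sqrt_nonneg _)
  · push Not at hs
    refine Real.le_sqrt_of_sq_le ?_
    have hpq : 0 ≤ p ^ 2 + q ^ 2 := by positivity
    nlinarith [sq_nonneg (α * q - β * p), mul_le_mul_of_nonneg_right h hpq]

/-- **Minkowski tested against one direction.** If `∫_a^b √(p² + q²) ≤ r ℓ`, `ℓ ≤ ∫_a^b p` and `1 < r`
(`a ≤ b`, `p, q` interval-integrable), then `∫_a^b q ≤ ℓ √(r² − 1)`. Proof: integrate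
`p/r + (√(r²−1)/r) q ≤ √(p²+q²)`. [folklore] -/
theorem integral_le_mul_sqrt_sq_sub_one {a b r ℓ : ℝ} (hab : a ≤ b) (hr : 1 < r) {p q : ℝ → ℝ}
    (hp : IntervalIntegrable p volume a b) (hq : IntervalIntegrable q volume a b)
    (hpq : IntervalIntegrable (fun t ↦ Real.sqrt (p t ^ 2 + q t ^ 2)) volume a b)
    (hlen : ∫ t in a..b, Real.sqrt (p t ^ 2 + q t ^ 2) ≤ r * ℓ) (hvert : ℓ ≤ ∫ t in a..b, p t) :
    ∫ t in a..b, q t ≤ ℓ * Real.sqrt (r ^ 2 - 1) := by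
  have hr0 : 0 < r := one_pos.trans hr
  have hr21 : 0 < r ^ 2 - 1 := by nlinarith
  set ρ : ℝ := Real.sqrt (r ^ 2 - 1) with hρ
  have hρ0 : 0 < ρ := Real.sqrt_pos.2 hr21
  have hρsq : ρ ^ 2 = r ^ 2 - 1 := Real.sq_sqrt hr21.le
  -- the unit vector `(1/r, ρ/r)`
  have hunit : (1 / r) ^ 2 + (ρ / r) ^ 2 ≤ 1 := by
    rw [div_pow, div_pow, hρsq, ← add_div, one_pow, div_le_one (by positivity)]
    linarith
  have hpt : ∀ t, (1 / r) * p t + (ρ / r) * q t ≤ Real.sqrt (p t ^ 2 + q t ^ 2) :=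
    fun t ↦ mul_add_mul_le_sqrt_sq_add_sq hunit (p t) (q t)
  have hint : ∫ t in a..b, ((1 / r) * p t + (ρ / r) * q t) ≤
      ∫ t in a..b, Real.sqrt (p t ^ 2 + q t ^ 2) :=
    intervalIntegral.integral_mono_on hab ((hp.const_mul _).add (hq.const_mul _)) hpq
      (fun t _ ↦ hpt t)
  rw [intervalIntegral.integral_add (hp.const_mul _) (hq.const_mul _),
    intervalIntegral.integral_const_mul, intervalIntegral.integral_const_mul] at hint
  -- `ℓ/r + (ρ/r) ∫q ≤ r ℓ`, i.e. `ρ ∫q ≤ (r² - 1) ℓ = ρ² ℓ`, i.e. `∫ q ≤ ρ ℓ`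
  set Q : ℝ := ∫ t in a..b, q t with hQ
  have h1 : (1 / r) * ℓ + (ρ / r) * Q ≤ r * ℓ := by
    have : (1 / r) * ℓ ≤ (1 / r) * ∫ t in a..b, p t :=
      mul_le_mul_of_nonneg_left hvert (by positivity)
    linarith
  have h2 : ℓ + ρ * Q ≤ r ^ 2 * ℓ := by
    have h := mul_le_mul_of_nonneg_left h1 hr0.le
    have e1 : r * ((1 / r) * ℓ + (ρ / r) * Q) = ℓ + ρ * Q := by
      field_simp
    have e2 : r * (r * ℓ) = r ^ 2 * ℓ := by ring
    linarith [h, e1, e2]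
  have h3 : ρ * Q ≤ ρ * (ρ * ℓ) := by
    have h3' : ρ * Q ≤ (r ^ 2 - 1) * ℓ := by linarith
    calc ρ * Q ≤ (r ^ 2 - 1) * ℓ := h3'
      _ = ρ * (ρ * ℓ) := by rw [← hρsq]; ring
  have h4 : Q ≤ ρ * ℓ := le_of_mul_le_mul_left h3 hρ0
  linarith [h4, mul_comm ρ ℓ]

/-- **Planar Minkowski inequality for interval integrals.** For interval-integrable `p, q` on
`[a,b]` (`a ≤ b`) with `√(p²+q²)` interval-integrable, `√((∫p)² + (∫q)²) ≤ ∫ √(p² + q²)`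
(test the pointwise Cauchy–Schwarz inequality against the unit vector `(∫p, ∫q)/‖(∫p, ∫q)‖`).
[folklore] -/
theorem sqrt_sq_integral_add_sq_integral_le {a b : ℝ} (hab : a ≤ b) {p q : ℝ → ℝ}
    (hp : IntervalIntegrable p volume a b) (hq : IntervalIntegrable q volume a b)
    (hpq : IntervalIntegrable (fun t ↦ Real.sqrt (p t ^ 2 + q t ^ 2)) volume a b) :
    Real.sqrt ((∫ t in a..b, p t) ^ 2 + (∫ t in a..b, q t) ^ 2) ≤
      ∫ t in a..b, Real.sqrt (p t ^ 2 + q t ^ 2) := by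
  set P : ℝ := ∫ t in a..b, p t with hP
  set Q : ℝ := ∫ t in a..b, q t with hQ
  set M : ℝ := Real.sqrt (P ^ 2 + Q ^ 2) with hM
  by_cases hM0 : M = 0
  · rw [hM0]
    exact intervalIntegral.integral_nonneg hab fun t _ ↦ Real.sqrt_nonneg _
  have hMpos : 0 < M := lt_of_le_of_ne (Real.sqrt_nonneg _) (Ne.symm hM0)
  have hMsq : M ^ 2 = P ^ 2 + Q ^ 2 := Real.sq_sqrt (by positivity)
  have hunit : (P / M) ^ 2 + (Q / M) ^ 2 ≤ 1 := by
    have hne : P ^ 2 + Q ^ 2 ≠ 0 := hMsq ▸ pow_ne_zero 2 hM0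
    rw [div_pow, div_pow, ← add_div, hMsq, div_self hne]
  have hpt : ∀ t, (P / M) * p t + (Q / M) * q t ≤ Real.sqrt (p t ^ 2 + q t ^ 2) :=
    fun t ↦ mul_add_mul_le_sqrt_sq_add_sq hunit (p t) (q t)
  have hint : ∫ t in a..b, ((P / M) * p t + (Q / M) * q t) ≤
      ∫ t in a..b, Real.sqrt (p t ^ 2 + q t ^ 2) :=
    intervalIntegral.integral_mono_on hab ((hp.const_mul _).add (hq.const_mul _)) hpq
      (fun t _ ↦ hpt t)
  rw [intervalIntegral.integral_add (hp.const_mul _) (hq.const_mul _),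
    intervalIntegral.integral_const_mul, intervalIntegral.integral_const_mul] at hint
  have hlhs : (P / M) * P + (Q / M) * Q = M := by
    field_simp
    linarith [hMsq]
  linarith [hint, hlhs]

/-- **Horizontal budget.** If `∫ √(p² + q²) ≤ L` and `ℓ ≤ ∫ p` with `0 ≤ ℓ`, then
`∫ q ≤ √(L² − ℓ²)`: the form used for near-minimisers (`L = r·ℓ + slack`). [folklore] -/
theorem integral_le_sqrt_sq_sub_sq {a b L ℓ : ℝ} (hab : a ≤ b) (hℓ : 0 ≤ ℓ) {p q : ℝ → ℝ}
    (hp : IntervalIntegrable p volume a b) (hq : IntervalIntegrable q volume a b)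
    (hpq : IntervalIntegrable (fun t ↦ Real.sqrt (p t ^ 2 + q t ^ 2)) volume a b)
    (hlen : ∫ t in a..b, Real.sqrt (p t ^ 2 + q t ^ 2) ≤ L) (hvert : ℓ ≤ ∫ t in a..b, p t) :
    ∫ t in a..b, q t ≤ Real.sqrt (L ^ 2 - ℓ ^ 2) := by
  have hmink := (sqrt_sq_integral_add_sq_integral_le hab hp hq hpq).trans hlen
  set P : ℝ := ∫ t in a..b, p t
  set Q : ℝ := ∫ t in a..b, q t
  have hL : 0 ≤ L := (Real.sqrt_nonneg _).trans hmink
  have h1 : P ^ 2 + Q ^ 2 ≤ L ^ 2 := by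
    have h := Real.sqrt_le_sqrt (sq_nonneg L) |> fun _ ↦ hmink
    calc P ^ 2 + Q ^ 2 = (Real.sqrt (P ^ 2 + Q ^ 2)) ^ 2 := (Real.sq_sqrt (by positivity)).symm
      _ ≤ L ^ 2 := by gcongr
  have h2 : ℓ ^ 2 ≤ P ^ 2 := by gcongr
  calc Q ≤ |Q| := le_abs_self Q
    _ = Real.sqrt (Q ^ 2) := (Real.sqrt_sq_eq_abs Q).symm
    _ ≤ Real.sqrt (L ^ 2 - ℓ ^ 2) := Real.sqrt_le_sqrt (by linarith)

/-- **Vertical cost.** For `λ` differentiable with continuous derivative and positive on `[a,b]`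
(`a ≤ b`), `log (λ b / λ a) ≤ ∫_a^b |λ' t| / λ t`: the integrand dominates `(log ∘ λ)'`.
[folklore] -/
theorem log_div_le_integral_abs_deriv_div {a b : ℝ} (hab : a ≤ b) {lam lam' : ℝ → ℝ}
    (hderiv : ∀ t ∈ Icc a b, HasDerivAt lam (lam' t) t) (hcont : ContinuousOn lam' (Icc a b))
    (hpos : ∀ t ∈ Icc a b, 0 < lam t) :
    Real.log (lam b / lam a) ≤ ∫ t in a..b, |lam' t| / lam t := by
  have hlam : ContinuousOn lam (Icc a b) :=
    fun t ht ↦ (hderiv t ht).continuousAt.continuousWithinAt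
  -- `(log ∘ λ)' = λ'/λ`
  have hlog : ∀ t ∈ Icc a b, HasDerivAt (fun u ↦ Real.log (lam u)) (lam' t / lam t) t :=
    fun t ht ↦ (hderiv t ht).log (hpos t ht).ne'
  have hcont' : ContinuousOn (fun t ↦ lam' t / lam t) (Icc a b) :=
    hcont.div hlam fun t ht ↦ (hpos t ht).ne'
  have hint : IntervalIntegrable (fun t ↦ lam' t / lam t) volume a b :=
    (hcont'.mono (by rw [uIcc_of_le hab])).intervalIntegrable
  have hftc : ∫ t in a..b, lam' t / lam t = Real.log (lam b) - Real.log (lam a) :=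
    intervalIntegral.integral_eq_sub_of_hasDerivAt
      (fun t ht ↦ hlog t (by rwa [uIcc_of_le hab] at ht)) hint
  rw [Real.log_div (hpos b ⟨hab, le_rfl⟩).ne' (hpos a ⟨le_rfl, hab⟩).ne', ← hftc]
  refine intervalIntegral.integral_mono_on hab hint ?_ fun t ht ↦ ?_
  · exact (((continuous_abs.comp_continuousOn hcont).div hlam fun t ht ↦ (hpos t ht).ne').mono
      (by rw [uIcc_of_le hab])).intervalIntegrable
  · exact div_le_div_of_nonneg_right (le_abs_self _) (hpos t ht).le

/-- **The numerical punchline at `ε = 1/20`.** With `r² = (1 + ε)/(1 − ε) = 21/19`,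
`2 r √(r² − 1) < √2`, i.e. the nearest-point spread ratio `0.682…` is below `√2`; equivalently
`4 r² (r² − 1) = 168/361 < 2`. [folklore] -/
theorem two_mul_r_sqrt_lt_sqrt_two :
    2 * Real.sqrt (21 / 19) * Real.sqrt (21 / 19 - 1) < Real.sqrt 2 := by
  have h2 : (2 : ℝ) = Real.sqrt 4 := by
    rw [show (4 : ℝ) = 2 ^ 2 by norm_num, Real.sqrt_sq (by norm_num)]
  have h1 : 2 * Real.sqrt (21 / 19) * Real.sqrt (21 / 19 - 1) =
      Real.sqrt (4 * (21 / 19) * (21 / 19 - 1)) := by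
    rw [Real.sqrt_mul (by norm_num), Real.sqrt_mul (by norm_num), h2]
  rw [h1]
  exact Real.sqrt_lt_sqrt (by norm_num) (by norm_num)

end Summit.SmoothPoincare4.SmoothPoincare4.Cruxes.C0AhRecognition.Prep

end
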